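import Summits.Parity.GeneralizedHardyLittlewood.Theses.PrimeLevelFamEdge
import Summits.Parity.GeneralizedHardyLittlewood.Theorems.PrimeLevelFamEdgeIdeaDeltasNegationKill
import Literature.NumberTheory.LFunctions.KMVMollifierDiagonalMainTerm
import Literature.NumberTheory.LFunctions.KMVDiagonalSlack
import Literature.NumberTheory.LFunctions.KMVSecondMainTermFloorMasses

/-!
# Sketch — crux idea «slack-recycling-kill» for `MomentsBeyondDiagonal` (stmt-Parity-20007)

Planner crux-ideate, ideator 1 (g39), route `PrimeLevelFamEdge`. First lemmas of the idea card
`idea-slack-recycling-kill.md`, all PROVED here (no `sorry`):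

* `theorem1_of_kA_datum_of_value` — the route's deciding theorem `closes` with the value crux `hB`
  DELETED and its conclusion inlined: ANY K_A datum `(Δ, T₁, T₂)` with `MomentAsymptotics 1 Δ T₁ T₂`
  plus a value-`> ¼` witness `(a, b, P)` on a sub-window below `3/2` gives `Theorem1` (body = `closes`).
* `exists_value_le_quarter_of_not_theorem1` — the SLACK CRITERION (contrapositive): in a `¬ Theorem1`
  world (deep exceptional characters at every scale) every K_A datum has value `≤ ¼` at SOME GENERIC
  length (`q̂^{Δ'} ∉ ℕ` for all `q ≥ 40`) of EVERY sub-window `(a, b) ⊆ [1, Δ]`, `a < 3/2`, for EVERY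
  admissible `P`.
* `exists_slack_le_T₂_of_not_theorem1` — the same as a ONE-SIDED FLOOR on the putative level-free
  off-diagonal functional: `diagSlack Δ' P 1 ≤ T₂ Δ' P 1` somewhere in every sub-window below `min Δ 2`
  (first correction pinned to `0` by Bettin's printed twisted first moment, `FirstMomentPrinted`).
* `OneSidedDeficitSomewhere` — the ENGINE target the idea proposes (a `def`, NOT asserted): in a
  `¬ Theorem1` world, along SOME infinite set of primes, the normalised mollified second moment at `Q = 1`
  sits BELOW `second + diagSlack` by a fixed margin on a whole sub-window of lengths below `3/2`.
  `KillViaSlack` / `killViaSlack_holds` — the composed certificate, PROVED: engine ⇒ printed supports ⇒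
  K_A ⇒ Theorem1, i.e. the route's circularity certificate «K_A ≥ leaf» WITHOUT K_B; the engine is the
  line's only open piece.

No statement about Landau–Siegel zeros is proved or asserted here; `Theorem1` (arXiv:2211.02515) appears
only as a hypothesis / conclusion of implications. KMV 2000 print the moment asymptotics for
`0 < Δ < 1` only (Props. 4.1/5.1, Lemma 3.3); nothing beyond the diagonal at a fixed level is claimed.
-/

noncomputable section

namespace Summit.Parity.GeneralizedHardyLittlewood.Cruxes.MomentsBeyondDiagonal.SlackKill

open Polynomial
open Literature.NumberTheory.LFunctions
open Summit.Parity.GeneralizedHardyLittlewood.Theses.PrimeLevelFamEdge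

/-- **L1 (kernel; = `closes` minus `hB`).** A K_A datum and a value-`> ¼` witness on a sub-window
below `3/2` give `Theorem1`, from the printed supports `TwistNonneg`, `TwistedHalfPrintedSqfreeLevel`,
`PeterssonBoundPrinted` exactly as in the route's deciding theorem. -/
theorem theorem1_of_kA_datum_of_value
    (hLR : TwistNonneg) (hTw : TwistedHalfPrintedSqfreeLevel) (hP : PeterssonBoundPrinted)
    {Δ : ℝ} {T₁ T₂ : ℝ → ℝ[X] → ℝ[X] → ℝ} (hMA : KMV2000.MomentAsymptotics 1 Δ T₁ T₂)
    {a b : ℝ} (ha1 : 1 ≤ a) (hab : a < b) (hbΔ : b ≤ Δ) (ha32 : a < 3 / 2)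
    {P : ℝ[X]} (hPadm : KMV2000.Admissible P)
    (hval : ∀ Δ' : ℝ, a < Δ' → Δ' < b → (∀ q : ℕ, 40 ≤ q → ∀ n : ℕ, (n : ℝ) ≠ KMV2000.qhat q ^ Δ') →
      1 / 4 < (KMV2000.linForm Δ' P 1 + T₁ Δ' P 1) ^ 2 /
        (2 * (KMV2000.secondMomentForm Δ' P 1 + T₂ Δ' P 1))) :
    Zhang2022.Skeleton.Theorem1 := by
  have hE : FamEdgeWeightTwo := by
    have hab' : a < min b (3 / 2) := lt_min hab ha32
    obtain ⟨Δ', ⟨haΔ', hΔ'b⟩, hgen⟩ :=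
      Literature.NumberTheory.LFunctions.KMV2000.exists_mem_Ioo_qhat_rpow_ne_nat hab'
    have hΔ'b' : Δ' < b := lt_of_lt_of_le hΔ'b (min_le_left _ _)
    have hΔ'32 : Δ' < 3 / 2 := lt_of_lt_of_le hΔ'b (min_le_right _ _)
    have h1Δ' : 1 < Δ' := lt_of_le_of_lt ha1 haΔ'
    have hΔ'0 : 0 < Δ' := by linarith
    have hR := hval Δ' haΔ' hΔ'b' hgen
    have hc₂ : 0 < Literature.NumberTheory.LFunctions.KMV2000.secondMomentForm Δ' P 1 + T₂ Δ' P 1 := by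
      by_contra h
      have h := not_lt.1 h
      have : (Literature.NumberTheory.LFunctions.KMV2000.linForm Δ' P 1 + T₁ Δ' P 1) ^ 2 /
          (2 * (Literature.NumberTheory.LFunctions.KMV2000.secondMomentForm Δ' P 1 + T₂ Δ' P 1)) ≤ 0 :=
        div_nonpos_of_nonneg_of_nonpos (sq_nonneg _) (by linarith)
      linarith
    exact Literature.NumberTheory.LFunctions.CentralValueFamilyHalfEdge.primeLevelFamilyTwo_EStarFam_of_momentAsymptotics_pb
      hP hLR hMA hPadm hΔ'0 h1Δ' (le_trans hΔ'b'.le hbΔ) ⟨40, fun q _ hq ↦ hgen q hq⟩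
      (Literature.NumberTheory.LFunctions.KMV2000.mollifierNormBound_of_petersson_pb hP P hΔ'0 hΔ'32) hc₂ hR
  obtain ⟨p₁, hp, hEp⟩ := hE
  have h4 : Literature.NumberTheory.LFunctions.Zhang2022.Skeleton.LOneLowerBound 4 := by
    refine Literature.NumberTheory.LFunctions.CentralValueFamilyHalfEdge.lOneLowerBound_of_eventual ?_
    obtain ⟨δ₁, hδ₁, htot⟩ :=
      Literature.NumberTheory.LFunctions.CentralValueFamilyHalfEdge.primeLevelFamilyTwo_mixedOverTotalMass
    have hε : 0 < (p₁ - 1 / 2) / 2 := by linarith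
    obtain ⟨δ₂, hδ₂, htw⟩ :=
      Literature.NumberTheory.LFunctions.CentralValueFamilyHalfEdge.primeLevelFamilyTwo_twistedHalf_of_twistedProportionPrime
        hε (Literature.NumberTheory.LFunctions.IwaniecSarnak.iwaniec2006_twistedHalf_sqfreeLevel.primeLevel
          hTw 2 le_rfl ⟨1, rfl⟩)
    have hδ : 0 < min δ₁ δ₂ := lt_min hδ₁ hδ₂
    obtain ⟨K, hK, hsup⟩ :=
      Literature.NumberTheory.LFunctions.CentralValueFamilyHalfEdge.primeLevelFamilyTwo_compatibleSupply hδ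
    have h := Literature.NumberTheory.LFunctions.CentralValueFamilyHalfEdge.CentralValueFamily.lOne_lowerBound_of_EStarFam_total'
      (𝓕 := Literature.NumberTheory.LFunctions.CentralValueFamilyHalfEdge.primeLevelFamilyTwo) hK
      (Literature.NumberTheory.LFunctions.CentralValueFamilyHalfEdge.primeLevelFamilyTwo_nonnegOn hLR)
      (fun _ _ _ _ hcomp =>
        Literature.NumberTheory.LFunctions.CentralValueFamilyHalfEdge.CentralValueFamily.refine_compatible_B hcomp)
      (Literature.NumberTheory.LFunctions.CentralValueFamilyHalfEdge.evenShare_primeLevelFamilyTwo_of_petersson_pb hP)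
      (htot.anti (min_le_left _ _)) (htw.anti (min_le_right _ _)) hEp (by linarith) hsup
    have h4' : ∃ c : ℝ, 0 < c ∧ ∃ D₀ : ℕ, ∀ (D : ℕ) [NeZero D] (χ : DirichletCharacter ℂ D), D₀ ≤ D →
        χ.IsPrimitive → MulChar.IsQuadratic χ → c * ((Real.log D) ^ 4)⁻¹ ≤ (χ.LFunction 1).re := by
      simpa only [show (2 * 2 : ℕ) = 4 from rfl] using h
    obtain ⟨c, hc, D₀, h⟩ := h4'
    exact ⟨c, hc, D₀, fun D _ χ hD hprim hquad => h D χ hD hprim hquad⟩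
  exact Literature.NumberTheory.LFunctions.Zhang2022.Section1.lOneLowerBound_mono (by norm_num) h4

/-- **L2 — THE SLACK CRITERION (kernel).** In a `¬ Theorem1` world every K_A datum `(Δ, T₁, T₂)` has
Cauchy–Schwarz value `≤ ¼` at SOME length `Δ'` of EVERY sub-window `(a, b) ⊆ [1, Δ]` with `a < 3/2`,
for EVERY admissible profile `P`. (So the negation of K_A in that world — the route's circularity
certificate «K_A ⇒ leaf» — needs only a ONE-SIDED contradiction with this floor.) -/
theorem exists_value_le_quarter_of_not_theorem1 (hS : ¬ Zhang2022.Skeleton.Theorem1)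
    (hLR : TwistNonneg) (hTw : TwistedHalfPrintedSqfreeLevel) (hP : PeterssonBoundPrinted)
    {Δ : ℝ} {T₁ T₂ : ℝ → ℝ[X] → ℝ[X] → ℝ} (hMA : KMV2000.MomentAsymptotics 1 Δ T₁ T₂)
    {a b : ℝ} (ha1 : 1 ≤ a) (hab : a < b) (hbΔ : b ≤ Δ) (ha32 : a < 3 / 2)
    {P : ℝ[X]} (hPadm : KMV2000.Admissible P) :
    ∃ Δ' : ℝ, a < Δ' ∧ Δ' < b ∧ (∀ q : ℕ, 40 ≤ q → ∀ n : ℕ, (n : ℝ) ≠ KMV2000.qhat q ^ Δ') ∧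
      (KMV2000.linForm Δ' P 1 + T₁ Δ' P 1) ^ 2 / (2 * (KMV2000.secondMomentForm Δ' P 1 + T₂ Δ' P 1))
        ≤ 1 / 4 := by
  by_contra h
  push Not at h
  exact hS (theorem1_of_kA_datum_of_value hLR hTw hP hMA ha1 hab hbΔ ha32 hPadm
    fun Δ' h₁ h₂ hg ↦ h Δ' h₁ h₂ hg)

/-- **L3 — the floor on the off-diagonal functional.** In a `¬ Theorem1` world, for every K_A datum,
every sub-window `(a, b) ⊆ [1, min Δ 2]` with `a < 3/2` and every admissible `P` there is a length
`Δ' ∈ (a, b)` at which (the first correction vanishing by Bettin, `FirstMomentPrinted`) the second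
correction is AT LEAST the diagonal slack: `diagSlack Δ' P 1 ≤ T₂ Δ' P 1` whenever the total second
main term is positive there (it is `≥ (lin + T₁)² ≥ 0` by the tree's Cauchy–Schwarz floor
`KMV2000.sq_firstMainTerm_le_secondMainTerm_of_masses`; the positivity guard is kept displayed). -/
theorem exists_slack_le_T₂_of_not_theorem1 (hS : ¬ Zhang2022.Skeleton.Theorem1)
    (hF : FirstMomentPrinted)
    (hLR : TwistNonneg) (hTw : TwistedHalfPrintedSqfreeLevel) (hP : PeterssonBoundPrinted)
    {Δ : ℝ} {T₁ T₂ : ℝ → ℝ[X] → ℝ[X] → ℝ} (hMA : KMV2000.MomentAsymptotics 1 Δ T₁ T₂)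
    {a b : ℝ} (ha1 : 1 ≤ a) (hab : a < b) (hbΔ : b ≤ min Δ 2) (ha32 : a < 3 / 2)
    {P : ℝ[X]} (hPadm : KMV2000.Admissible P) :
    ∃ Δ' : ℝ, a < Δ' ∧ Δ' < b ∧ (∀ q : ℕ, 40 ≤ q → ∀ n : ℕ, (n : ℝ) ≠ KMV2000.qhat q ^ Δ') ∧
      T₁ Δ' P 1 = 0 ∧
      (0 < KMV2000.secondMomentForm Δ' P 1 + T₂ Δ' P 1 →
        KMV2000.diagSlack Δ' P 1 ≤ T₂ Δ' P 1) := by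
  obtain ⟨Δ', h₁, h₂, hg, hle⟩ := exists_value_le_quarter_of_not_theorem1 hS hLR hTw hP hMA ha1 hab
    (le_trans hbΔ (min_le_left _ _)) ha32 hPadm
  have h1Δ' : 1 < Δ' := lt_of_le_of_lt ha1 h₁
  have hΔ'2 : Δ' < min Δ 2 := lt_of_lt_of_le h₂ hbΔ
  have hT₁ : T₁ Δ' P 1 = 0 := KMV2000.T₁_apply_one_eq_zero_of_bettin hF hPadm hMA h1Δ' hΔ'2
  refine ⟨Δ', h₁, h₂, hg, hT₁, fun hpos ↦ ?_⟩
  by_contra hlt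
  push Not at hlt
  have hq : 1 / 4 < KMV2000.valueWith Δ' P 1 0 (T₂ Δ' P 1) :=
    (KMV2000.quarter_lt_valueWith_zero_iff (Δ := Δ') (P := P) (Q := 1) hpos).2 hlt
  unfold KMV2000.valueWith at hq
  rw [hT₁] at hle
  linarith

/-- The normalising scale of the second display: `2ζ(2)² · q̂/(Δ'² log² q̂)` (as a real number,
`ζ(2) = π²/6`). -/
def mainScale₂ (q : ℕ) (Δ' : ℝ) : ℝ :=
  2 * (Real.pi ^ 2 / 6) ^ 2 * (KMV2000.qhat q / (Δ' ^ 2 * Real.log (KMV2000.qhat q) ^ 2))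

/-- **ENGINE TARGET (proposed, NOT asserted): one-sided second-moment deficit somewhere.** In a
`¬ Theorem1` world there is a sub-window `(a, b) ⊆ [1, 3/2)` and an admissible profile `P` such that at
every generic length `Δ' ∈ (a, b)` the normalised mollified second moment at `Q = 1` lies BELOW
`second + diagSlack − δ = 2·lin² − δ` along an infinite set of primes (one class, one height regime
suffice; `∃ q`, so level averaging is legal); sub-windows are required below every `Δ > 1` because K_A's
window is not known in advance. The exceptional modulus `D` enters HERE and only here, as the modulus of
the assumed exceptional characters; nothing is excluded. -/
def OneSidedDeficitSomewhere : Prop :=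
  ¬ Zhang2022.Skeleton.Theorem1 → ∀ Δ : ℝ, 1 < Δ →
    ∃ a b : ℝ, 1 ≤ a ∧ a < b ∧ b ≤ Δ ∧ b ≤ 3 / 2 ∧ ∃ P : ℝ[X], KMV2000.Admissible P ∧
      ∀ Δ' : ℝ, a < Δ' → Δ' < b → (∀ q : ℕ, 40 ≤ q → ∀ n : ℕ, (n : ℝ) ≠ KMV2000.qhat q ^ Δ') →
        ∃ δ : ℝ, 0 < δ ∧ ∀ q₀ : ℕ, ∃ (q : ℕ) (_ : NeZero q), q.Prime ∧ q₀ ≤ q ∧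
          ‖KMV2000.QhPQ q P 1 (KMV2000.qhat q ^ Δ')‖ ≤
            mainScale₂ q Δ' * (KMV2000.secondMomentForm Δ' P 1 + KMV2000.diagSlack Δ' P 1 - δ)

/-- **The composed certificate the line aims at**: engine ⇒ printed supports ⇒ (K_A ⇒ Theorem1), i.e.
the route's circularity certificate «`MomentsBeyondDiagonal` is at least the leaf» with K_B bypassed.
PROVED below (`killViaSlack_holds`): the engine is the line's ONLY open piece. -/
def KillViaSlack : Prop :=
  OneSidedDeficitSomewhere → FirstMomentPrinted → TwistNonneg → TwistedHalfPrintedSqfreeLevel →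
    PeterssonBoundPrinted → MomentsBeyondDiagonal → Zhang2022.Skeleton.Theorem1

/-- **L4 — THE COMPOSITION IS KERNEL-CHECKED: `KillViaSlack` holds.** The engine target
`OneSidedDeficitSomewhere` ALONE (plus the route's printed supports, all proved or cited in the tree)
turns K_A into the leaf: `MomentsBeyondDiagonal → Theorem1` with K_B bypassed — the route's circularity
certificate. Proof: in a `¬ Theorem1` world take the engine's sub-window and profile, the generic length
`Δ'` of L3 in it, Kowalski–Michel–VanderKam's second display at `Δ'` along the engine's primes, the
Cauchy–Schwarz floor `lin² ≤ second + T₂` (`KMV2000.sq_firstMainTerm_le_secondMainTerm_of_lt_two_of_masses`,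
masses from the repaired Petersson bound), and compare: `T₂ ≤ diagSlack − δ/2 < diagSlack ≤ T₂`. -/
theorem killViaSlack_holds : KillViaSlack := by
  intro hE hF hLR hTw hP hA
  by_contra hS
  obtain ⟨Δ, hΔ, T₁, T₂, hMA⟩ := hA
  obtain ⟨a, b, ha1, hab, hbΔ, hb32, P, hPadm, hdef⟩ := hE hS Δ hΔ
  have ha32 : a < 3 / 2 := lt_of_lt_of_le hab hb32
  have hb2 : b ≤ min Δ 2 := le_min hbΔ (by linarith)
  obtain ⟨Δ', h₁, h₂, hg, hT₁, hfloor⟩ :=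
    exists_slack_le_T₂_of_not_theorem1 hS hF hLR hTw hP hMA ha1 hab hb2 ha32 hPadm
  have h1Δ' : 1 < Δ' := lt_of_le_of_lt ha1 h₁
  have hΔ'0 : 0 < Δ' := by linarith
  have hΔ'Δ : Δ' ≤ Δ := h₂.le.trans hbΔ
  have hΔ'2 : Δ' < 2 := by linarith [lt_of_lt_of_le h₂ hb32]
  obtain ⟨δ, hδ, hio⟩ := hdef Δ' h₁ h₂ hg
  -- the two harmonic masses from the repaired Petersson bound
  have Ht : ∃ C a : ℝ, 0 < a ∧ ∀ (q : ℕ) [NeZero q], q.Prime →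
      |IwaniecSarnak.harmonicSum q 2 (fun _ ↦ (1 : ℝ)) - 1| ≤ C * (q : ℝ) ^ (-a) := by
    obtain ⟨C, hC⟩ := CentralValueFamilyHalfEdge.abs_totalMass_sub_one_le_pb hP
    exact ⟨C, 3 / 2, by norm_num, fun q _ hq ↦ hC q hq⟩
  have He : ∃ C a : ℝ, 0 < a ∧ ∀ (q : ℕ) [NeZero q], q.Prime →
      |2 * IwaniecSarnak.harmonicSum q 2
            (fun f ↦ if IwaniecSarnak.rootNumber f = 1 then (1 : ℝ) else 0) -
          IwaniecSarnak.harmonicSum q 2 (fun _ ↦ (1 : ℝ))| ≤ C * (q : ℝ) ^ (-a) := by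
    obtain ⟨C, hC⟩ := CentralValueFamilyHalfEdge.abs_two_mul_evenMass_sub_totalMass_le_pb hP
    exact ⟨C, 1 / 4, by norm_num, fun q _ hq ↦ hC q hq⟩
  -- abbreviations: ℓ = lin, c₂ = second + T₂; second + diagSlack = 2ℓ²
  set ℓ : ℝ := KMV2000.linForm Δ' P 1 with hℓ_def
  set σ : ℝ := KMV2000.secondMomentForm Δ' P 1 with hσ_def
  set c₂ : ℝ := σ + T₂ Δ' P 1 with hc₂_def
  have hslack : KMV2000.diagSlack Δ' P 1 = 2 * ℓ ^ 2 - σ := by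
    simp only [KMV2000.diagSlack, hℓ_def, hσ_def]
  -- the Cauchy–Schwarz floor `ℓ² ≤ c₂` (first correction pinned to 0)
  have hfl : ℓ ^ 2 ≤ c₂ := by
    have h := KMV2000.sq_firstMainTerm_le_secondMainTerm_of_lt_two_of_masses Ht He hMA hPadm hΔ'0
      hΔ'2 h1Δ' hΔ'Δ
    rw [hT₁, add_zero] at h
    exact h
  -- KMV's second display at the generic length Δ'
  obtain ⟨C, q₀, H⟩ := hMA P 1 hPadm KMV2000.isEvenOrOdd_one Δ' h1Δ' hΔ'Δ
  set α : ℝ := Real.pi ^ 2 / 6 with hα_def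
  have hα : 0 < α := by positivity
  have hζ : riemannZeta 2 = (α : ℂ) := by rw [riemannZeta_two, hα_def]; push_cast; ring
  -- a large prime from the engine
  obtain ⟨N₁, hN₁⟩ := KMV2000.exists_log_qhat_ge (max 1 (|C| * Δ' ^ 2 / (α ^ 2 * δ)))
  obtain ⟨q, hqne, hq, hqge, hQh⟩ := hio (max (max q₀ 40) N₁)
  have hq₀ : q₀ ≤ q := le_trans (le_trans (le_max_left _ _) (le_max_left _ _)) hqge
  have hq40 : 40 ≤ q := le_trans (le_trans (le_max_right _ _) (le_max_left _ _)) hqge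
  have hqN : N₁ ≤ q := le_trans (le_max_right _ _) hqge
  have hqhat0 : 0 < KMV2000.qhat q := lt_trans one_pos (KMV2000.one_lt_qhat hq40)
  set x : ℝ := Real.log (KMV2000.qhat q) with hx_def
  have hx1 : max 1 (|C| * Δ' ^ 2 / (α ^ 2 * δ)) ≤ x := hN₁ q hqN
  have hx0 : 0 < x := lt_of_lt_of_le one_pos (le_trans (le_max_left _ _) hx1)
  have hxC : |C| * Δ' ^ 2 / (α ^ 2 * δ) ≤ x := le_trans (le_max_right _ _) hx1
  set s : ℝ := 2 * α ^ 2 * (KMV2000.qhat q / (Δ' ^ 2 * x ^ 2)) with hs_def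
  have hs : 0 < s := by positivity
  have hms : mainScale₂ q Δ' = s := by
    simp only [mainScale₂, hs_def, hα_def, hx_def]
  obtain ⟨-, h2nd⟩ := H q hq hq₀ (hg q hq40)
  have hcast : (2 * riemannZeta 2 ^ 2 *
        ((KMV2000.qhat q / (Δ' ^ 2 * Real.log (KMV2000.qhat q) ^ 2) : ℝ) : ℂ)) *
          ((KMV2000.secondMomentForm Δ' P 1 + T₂ Δ' P 1 : ℝ) : ℂ) = ((s * c₂ : ℝ) : ℂ) := by
    rw [hζ, hs_def, hc₂_def, hσ_def, hx_def]
    push_cast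
    ring
  rw [hcast] at h2nd
  -- triangle inequality: |s c₂| ≤ ‖Q^h‖ + C q̂ x⁻¹³
  have htri : |s * c₂| ≤ ‖KMV2000.QhPQ q P 1 (KMV2000.qhat q ^ Δ')‖ +
      C * KMV2000.qhat q * (Real.log (KMV2000.qhat q))⁻¹ ^ 3 := by
    have hsum : KMV2000.QhPQ q P 1 (KMV2000.qhat q ^ Δ') +
        (((s * c₂ : ℝ) : ℂ) - KMV2000.QhPQ q P 1 (KMV2000.qhat q ^ Δ')) = ((s * c₂ : ℝ) : ℂ) := by
      ring
    have h1 := norm_add_le (KMV2000.QhPQ q P 1 (KMV2000.qhat q ^ Δ'))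
      (((s * c₂ : ℝ) : ℂ) - KMV2000.QhPQ q P 1 (KMV2000.qhat q ^ Δ'))
    rw [hsum, norm_sub_rev, Complex.norm_real, Real.norm_eq_abs] at h1
    linarith
  -- the engine's one-sided bound at this prime
  rw [hms, hslack] at hQh
  have hQh' : ‖KMV2000.QhPQ q P 1 (KMV2000.qhat q ^ Δ')‖ ≤ s * (2 * ℓ ^ 2 - δ) := by
    have : σ + (2 * ℓ ^ 2 - σ) - δ = 2 * ℓ ^ 2 - δ := by ring
    rw [this] at hQh
    exact hQh
  -- the error term is at most s·δ/2 once log q̂ ≥ |C| Δ'²/(α² δ)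
  have herr : C * KMV2000.qhat q * (Real.log (KMV2000.qhat q))⁻¹ ^ 3 ≤ s * (δ / 2) := by
    rw [← hx_def]
    have hq3 : 0 ≤ KMV2000.qhat q * x⁻¹ ^ 3 := by positivity
    have hCle : C * KMV2000.qhat q * x⁻¹ ^ 3 ≤ |C| * KMV2000.qhat q * x⁻¹ ^ 3 := by
      rw [mul_assoc, mul_assoc]
      exact mul_le_mul_of_nonneg_right (le_abs_self C) hq3
    have hkey : |C| * Δ' ^ 2 ≤ x * (α ^ 2 * δ) := (div_le_iff₀ (by positivity)).1 hxC
    have hrew1 : |C| * KMV2000.qhat q * x⁻¹ ^ 3 = (|C| * Δ' ^ 2) * (KMV2000.qhat q / (Δ' ^ 2 * x ^ 3)) := by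
      field_simp
    have hrew2 : s * (δ / 2) = (x * (α ^ 2 * δ)) * (KMV2000.qhat q / (Δ' ^ 2 * x ^ 3)) := by
      rw [hs_def]
      field_simp
    rw [hrew1] at hCle
    rw [hrew2]
    exact le_trans hCle (mul_le_mul_of_nonneg_right hkey (by positivity))
  -- compare: s c₂ ≤ |s c₂| ≤ s(2ℓ² − δ/2)
  have hcmp : s * c₂ ≤ s * (2 * ℓ ^ 2 - δ / 2) := by
    have := le_abs_self (s * c₂)
    nlinarith [htri, hQh', herr]
  have hc₂le : c₂ ≤ 2 * ℓ ^ 2 - δ / 2 := le_of_mul_le_mul_left hcmp hs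
  -- positivity of the total second main term: 0 ≤ |s c₂| ≤ s(2ℓ² − δ/2) ⇒ ℓ² ≥ δ/4 > 0, and ℓ² ≤ c₂
  have hℓpos : δ / 4 ≤ ℓ ^ 2 := by
    have h0 : 0 ≤ s * (2 * ℓ ^ 2 - δ / 2) := by nlinarith [abs_nonneg (s * c₂), htri, hQh', herr]
    have : 0 ≤ 2 * ℓ ^ 2 - δ / 2 := nonneg_of_mul_nonneg_right (by simpa [mul_comm] using h0) hs
    linarith
  have hpos : 0 < KMV2000.secondMomentForm Δ' P 1 + T₂ Δ' P 1 := by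
    change 0 < c₂
    linarith
  have hfloorT : KMV2000.diagSlack Δ' P 1 ≤ T₂ Δ' P 1 := hfloor hpos
  rw [hslack] at hfloorT
  -- T₂ = c₂ − σ ≤ 2ℓ² − σ − δ/2 < 2ℓ² − σ ≤ T₂
  have : T₂ Δ' P 1 = c₂ - σ := by rw [hc₂_def]; ring
  linarith

/-- Sanity (kernel): the slack of the optimal one-piece profile is POSITIVE beyond the diagonal —
`diagSlack Δ' X² 1 = 4(Δ' − 1)/Δ' > 0` for `Δ' > 1` — so L3 is a genuine positive floor on `T₂` there. -/
theorem diagSlack_X_sq_pos {Δ' : ℝ} (h : 1 < Δ') : 0 < KMV2000.diagSlack Δ' (X ^ 2) 1 := by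
  rw [KMV2000.diagSlack_X_sq_one (by linarith)]
  have : 0 < Δ' := by linarith
  positivity

end Summit.Parity.GeneralizedHardyLittlewood.Cruxes.MomentsBeyondDiagonal.SlackKill
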